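import Summits.AtomisticToContinuum.Crystallization.Theorems.ChargedEnergyGapOctahedralLedgerA
import HarnessLib

/-!
# ChargedEnergyGap · NODE 73 «OctahedralLedger», part B (lens-3 g73): the plateau piece (K₀) PROVED at the designate

* §B1 the octahedron certificate IN DISPLACEMENT FORM (PROVED, pure algebra): for the eighteen atoms `A i p = ⟪fᵢ, u_p⟫` of six vertex displacements
  in a frame, `Σ_a D_a² ≤ Σ_{12 edges} e′²` — the landed `octahedron_certificate` composed with the exact linear identities `D_a = ¼(T′ − 2Q′_a)`
  (diagonal elongation from edge elongations; formal in the atoms, checked `num/ident_check.py`).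
* §B2 frame geometry (PROVED): vertex differences, edge length `ρ√2`, diagonal `2ρ`, diameter `≤ 2ρ`, injectivity of the vertex map, the
  longitudinal components of a coboundary on edges `(s′⟪f_j,Δu⟫ − s⟪f_i,Δu⟫)/√2` and diagonals `±⟪f_i,Δu⟫`.
* §B3 the octahedron form ON A FRAME (PROVED): the double `finsum` is the double sum over the six vertices (`finsum_eq_sum_of_support_subset`,
  `Finset.sum_image`), and on a clean plateau octahedron carrying a coboundary it is `W₀·[¼Σe′² + (c(2ρ)/2)ΣD²] ≥ W₀(¼ − ¼)… ≥ 0` by §B1 and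
  `−½ ≤ c(2ρ) = 14t¹⁴ − 8t⁸` on the window `ρ ∈ [0.679, 0.691]` (PROVED, tangent-line bounds).
* §B4 ★★ (K₀) `OctPlateauQ cls s lam ℓ μ₀ (3/100) ϱ b₀ r_S b₁ ϱχ (6/5) (3/2) (1/2) (679/1000) (691/1000)` PROVED for EVERY class and every
  quantisation floor `b₁ ≥ 1/8` (local exactness: `3·(3/100)·2ρ ≤ 0.1244 < 1/8`).  Part C carries the cones with (K₀) (and (G)) discharged.
-/

noncomputable section

open scoped Classical
open Literature.MathematicalPhysics.StatisticalMechanics Literature.Geometry.DiscreteGeometry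
open Summit.AtomisticToContinuum.Crystallization.Theses.PricedLinkCensus
open Summit.AtomisticToContinuum.Crystallization.Theorems.ChargedEnergyGapNegative

namespace Summit.AtomisticToContinuum.Crystallization.Theorems.ChargedEnergyGapChartDial

/-! ## §B1 The octahedron certificate in displacement form (PROVED) -/

section Algebra

/-- ★ **DISPLACEMENT CERTIFICATE**.  Atoms `A i (j, b) = ⟪fᵢ, u_{(j,b)}⟫` (vertex `(j, b)` = `c ± ρf_j`); the diagonal elongation along axis `a` is
`D_a = A a (a,+) − A a (a,−)`, the edge elongation (times `√2`) of the edge `(i,b)(j,b′)` is `e′ = s′(A j q − A j p) − s(A i q − A i p)`; then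
`Σ_a D_a² ≤ Σ_{12 edges} e′²` (from `octahedron_certificate` through the identities `D_a = ¼(T′ − 2Q′_a)`, which `linear_combination` verifies). -/
theorem octahedron_disp_certificate (A : Fin 3 → Fin 3 × Bool → ℝ) :
    (A 0 (0, true) - A 0 (0, false)) ^ 2 + (A 1 (1, true) - A 1 (1, false)) ^ 2 + (A 2 (2, true) - A 2 (2, false)) ^ 2 ≤
      ((A 1 (1, true) - A 1 (0, true)) - (A 0 (1, true) - A 0 (0, true))) ^ 2 +
      (-(A 1 (1, false) - A 1 (0, true)) - (A 0 (1, false) - A 0 (0, true))) ^ 2 +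
      ((A 2 (2, true) - A 2 (0, true)) - (A 0 (2, true) - A 0 (0, true))) ^ 2 +
      (-(A 2 (2, false) - A 2 (0, true)) - (A 0 (2, false) - A 0 (0, true))) ^ 2 +
      ((A 1 (1, true) - A 1 (0, false)) + (A 0 (1, true) - A 0 (0, false))) ^ 2 +
      (-(A 1 (1, false) - A 1 (0, false)) + (A 0 (1, false) - A 0 (0, false))) ^ 2 +
      ((A 2 (2, true) - A 2 (0, false)) + (A 0 (2, true) - A 0 (0, false))) ^ 2 +
      (-(A 2 (2, false) - A 2 (0, false)) + (A 0 (2, false) - A 0 (0, false))) ^ 2 +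
      ((A 2 (2, true) - A 2 (1, true)) - (A 1 (2, true) - A 1 (1, true))) ^ 2 +
      (-(A 2 (2, false) - A 2 (1, true)) - (A 1 (2, false) - A 1 (1, true))) ^ 2 +
      ((A 2 (2, true) - A 2 (1, false)) + (A 1 (2, true) - A 1 (1, false))) ^ 2 +
      (-(A 2 (2, false) - A 2 (1, false)) + (A 1 (2, false) - A 1 (1, false))) ^ 2 := by
  have h := octahedron_certificate
    ((A 1 (1, true) - A 1 (0, true)) - (A 0 (1, true) - A 0 (0, true)))
    (-(A 1 (1, false) - A 1 (0, true)) - (A 0 (1, false) - A 0 (0, true)))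
    ((A 2 (2, true) - A 2 (0, true)) - (A 0 (2, true) - A 0 (0, true)))
    (-(A 2 (2, false) - A 2 (0, true)) - (A 0 (2, false) - A 0 (0, true)))
    ((A 1 (1, true) - A 1 (0, false)) + (A 0 (1, true) - A 0 (0, false)))
    (-(A 1 (1, false) - A 1 (0, false)) + (A 0 (1, false) - A 0 (0, false)))
    ((A 2 (2, true) - A 2 (0, false)) + (A 0 (2, true) - A 0 (0, false)))
    (-(A 2 (2, false) - A 2 (0, false)) + (A 0 (2, false) - A 0 (0, false)))
    ((A 2 (2, true) - A 2 (1, true)) - (A 1 (2, true) - A 1 (1, true)))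
    (-(A 2 (2, false) - A 2 (1, true)) - (A 1 (2, false) - A 1 (1, true)))
    ((A 2 (2, true) - A 2 (1, false)) + (A 1 (2, true) - A 1 (1, false)))
    (-(A 2 (2, false) - A 2 (1, false)) + (A 1 (2, false) - A 1 (1, false)))
  linear_combination (1 / 16) * h

/-- The window bound behind (K₀): for `t ∈ [500/691, 500/679]` (`t = 1/(2ρ)`, `ρ ∈ [0.679, 0.691]`), `8t⁸ − 14t¹⁴ ≤ ½`, i.e.
`−½ ≤ c(2ρ) = 14t¹⁴ − 8t⁸` (value `0.49867` at the upper end, margin `1.3e-3`).  TANGENT-LINE bounds at `T = 500/679` with their exact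
`(T − t)²`-factorisations (`T⁸ − t⁸ ≥ 8t⁷(T − t)`, `T¹⁴ − t¹⁴ ≤ 14T¹³(T − t)`) and the slope comparison `196T¹³ ≤ 64(500/691)⁷ ≤ 64t⁷`
reduce it to the value at `T` (the polynomial is increasing on the window). -/
theorem ljBar_window_poly {t : ℝ} (h0 : 500 / 691 ≤ t) (h1 : t ≤ 500 / 679) : 8 * t ^ 8 - 14 * t ^ 14 ≤ 1 / 2 := by
  have ht : 0 < t := by linarith
  have hTt : 0 ≤ 500 / 679 - t := by linarith
  have hA : 8 * (500 / 679) * t ^ 7 - 8 * t ^ 8 ≤ (500 / 679 : ℝ) ^ 8 - t ^ 8 := by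
    rw [← sub_nonneg]
    have e : (500 / 679 : ℝ) ^ 8 - t ^ 8 - (8 * (500 / 679) * t ^ 7 - 8 * t ^ 8) = (500 / 679 - t) ^ 2 *
        ((500 / 679) ^ 6 + 2 * (500 / 679) ^ 5 * t + 3 * (500 / 679) ^ 4 * t ^ 2 + 4 * (500 / 679) ^ 3 * t ^ 3 +
          5 * (500 / 679) ^ 2 * t ^ 4 + 6 * (500 / 679) * t ^ 5 + 7 * t ^ 6) := by ring
    rw [e]; positivity
  have hB : (500 / 679 : ℝ) ^ 14 - t ^ 14 ≤ 14 * (500 / 679) ^ 14 - 14 * (500 / 679) ^ 13 * t := by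
    rw [← sub_nonneg]
    have e : 14 * (500 / 679 : ℝ) ^ 14 - 14 * (500 / 679) ^ 13 * t - ((500 / 679) ^ 14 - t ^ 14) = (500 / 679 - t) ^ 2 *
        (t ^ 12 + 2 * t ^ 11 * (500 / 679) + 3 * t ^ 10 * (500 / 679) ^ 2 + 4 * t ^ 9 * (500 / 679) ^ 3 +
          5 * t ^ 8 * (500 / 679) ^ 4 + 6 * t ^ 7 * (500 / 679) ^ 5 + 7 * t ^ 6 * (500 / 679) ^ 6 + 8 * t ^ 5 * (500 / 679) ^ 7 +
          9 * t ^ 4 * (500 / 679) ^ 8 + 10 * t ^ 3 * (500 / 679) ^ 9 + 11 * t ^ 2 * (500 / 679) ^ 10 + 12 * t * (500 / 679) ^ 11 +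
          13 * (500 / 679) ^ 12) := by ring
    rw [e]; positivity
  have h7 : (500 / 691 : ℝ) ^ 7 ≤ t ^ 7 := pow_le_pow_left₀ (by norm_num) h0 7
  have hS : 0 ≤ 64 * t ^ 7 - 196 * (500 / 679 : ℝ) ^ 13 := by
    have : (196 : ℝ) * (500 / 679) ^ 13 ≤ 64 * (500 / 691) ^ 7 := by norm_num
    linarith
  have hP : 0 ≤ 64 * (500 / 679) * t ^ 7 - 64 * t ^ 8 - 196 * (500 / 679 : ℝ) ^ 14 + 196 * (500 / 679) ^ 13 * t := by
    have := mul_nonneg hTt hS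
    have e : (500 / 679 - t) * (64 * t ^ 7 - 196 * (500 / 679 : ℝ) ^ 13) =
        64 * (500 / 679) * t ^ 7 - 64 * t ^ 8 - 196 * (500 / 679 : ℝ) ^ 14 + 196 * (500 / 679) ^ 13 * t := by ring
    linarith
  have hTop : 8 * (500 / 679 : ℝ) ^ 8 - 14 * (500 / 679) ^ 14 ≤ 1 / 2 := by norm_num
  linarith

/-- `−½ ≤ c(2ρ) := V″(2ρ) − V′(2ρ)/(2ρ)` on the half-diagonal window `[0.679, 0.691]` (so `κ₂ = ½ ≥ |c|`: the plateau slack is `≥ 0`). -/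
theorem ljBar_diag_window {ρ : ℝ} (h0 : 679 / 1000 ≤ ρ) (h1 : ρ ≤ 691 / 1000) :
    -(1 / 2) ≤ ljD2 (2 * ρ) - ljD1 (2 * ρ) / (2 * ρ) := by
  have hρ : 0 < 2 * ρ := by linarith
  set t := (2 * ρ)⁻¹ with ht
  have hc : ljD2 (2 * ρ) - ljD1 (2 * ρ) / (2 * ρ) = 14 * t ^ 14 - 8 * t ^ 8 := by
    unfold ljD2 ljD1; rw [div_eq_mul_inv]; ring
  have ht0 : 500 / 691 ≤ t := by rw [ht, le_inv_comm₀ (by norm_num) hρ]; linarith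
  have ht1 : t ≤ 500 / 679 := by rw [ht, inv_le_comm₀ hρ (by norm_num)]; linarith
  have := ljBar_window_poly ht0 ht1
  rw [hc]; linarith

end Algebra

/-! ## §B2 Frame geometry (PROVED) -/

section Geometry

/-- The sign of a vertex flag: `+1` for `true`, `−1` for `false`. -/
def sgnB (b : Bool) : ℝ := if b then 1 else -1

/-- `sgnB_sq` (docstring added by the landing lane; see the module docstring). [formal bookkeeping] -/
theorem sgnB_sq (b : Bool) : sgnB b ^ 2 = 1 := by cases b <;> simp [sgnB]

/-- `octVertex_eq_sgnB` (docstring added by the landing lane; see the module docstring). [formal bookkeeping] -/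
theorem octVertex_eq_sgnB (c : E3) (f : Fin 3 → E3) (ρ : ℝ) (i : Fin 3) (b : Bool) :
    octVertex c f ρ i b = c + (sgnB b * ρ) • f i := by
  cases b <;> simp [octVertex, sgnB]

/-- `octVertex_sub` (docstring added by the landing lane; see the module docstring). [formal bookkeeping] -/
theorem octVertex_sub (c : E3) (f : Fin 3 → E3) (ρ : ℝ) (i j : Fin 3) (b b' : Bool) :
    octVertex c f ρ j b' - octVertex c f ρ i b = (sgnB b' * ρ) • f j - (sgnB b * ρ) • f i := by
  rw [octVertex_eq_sgnB, octVertex_eq_sgnB]; abel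

variable {c : E3} {f : Fin 3 → E3} {ρ : ℝ}

/-- In an orthonormal frame, `‖a•f_j − b•f_i‖² = a² + b²` for `i ≠ j`. -/
theorem norm_sq_frame_comb (hf : Orthonormal ℝ f) {i j : Fin 3} (hij : i ≠ j) (a b : ℝ) :
    ‖a • f j - b • f i‖ ^ 2 = a ^ 2 + b ^ 2 := by
  rw [norm_sub_sq_real, norm_smul, norm_smul, hf.1 i, hf.1 j, inner_smul_left, inner_smul_right, hf.2 (Ne.symm hij)]
  simp [Real.norm_eq_abs, sq_abs]

/-- Edge length `ρ√2`. -/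
theorem dist_octVertex_edge (hf : Orthonormal ℝ f) (hρ : 0 ≤ ρ) {i j : Fin 3} (hij : i ≠ j) (b b' : Bool) :
    dist (octVertex c f ρ i b) (octVertex c f ρ j b') = ρ * Real.sqrt 2 := by
  rw [dist_comm, dist_eq_norm, octVertex_sub]
  have hsq : ‖(sgnB b' * ρ) • f j - (sgnB b * ρ) • f i‖ ^ 2 = (ρ * Real.sqrt 2) ^ 2 := by
    rw [norm_sq_frame_comb hf hij, mul_pow, mul_pow, sgnB_sq, sgnB_sq, mul_pow, Real.sq_sqrt (by norm_num : (0:ℝ) ≤ 2)]; ring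
  have h1 : 0 ≤ ρ * Real.sqrt 2 := mul_nonneg hρ (Real.sqrt_nonneg _)
  nlinarith [norm_nonneg ((sgnB b' * ρ) • f j - (sgnB b * ρ) • f i), sq_nonneg (‖(sgnB b' * ρ) • f j - (sgnB b * ρ) • f i‖ - ρ * Real.sqrt 2)]

/-- Diagonal length `2ρ`. -/
theorem dist_octVertex_diag (hf : Orthonormal ℝ f) (hρ : 0 ≤ ρ) (i : Fin 3) {b b' : Bool} (hbb : b ≠ b') :
    dist (octVertex c f ρ i b) (octVertex c f ρ i b') = 2 * ρ := by
  rw [dist_comm, dist_eq_norm, octVertex_sub, ← sub_smul, norm_smul, hf.1 i, mul_one, Real.norm_eq_abs, ← sub_mul, abs_mul,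
    abs_of_nonneg hρ]
  have hs : sgnB b' - sgnB b = 2 ∨ sgnB b' - sgnB b = -2 := by
    cases b <;> cases b' <;> simp_all [sgnB] <;> norm_num
  rcases hs with h | h <;> rw [h] <;> norm_num

/-- Diameter `≤ 2ρ`. -/
theorem dist_octVertex_le (hf : Orthonormal ℝ f) (hρ : 0 ≤ ρ) (i j : Fin 3) (b b' : Bool) :
    dist (octVertex c f ρ i b) (octVertex c f ρ j b') ≤ 2 * ρ := by
  rw [dist_comm, dist_eq_norm, octVertex_sub]
  refine (norm_sub_le _ _).trans ?_
  rw [norm_smul, norm_smul, hf.1 i, hf.1 j, Real.norm_eq_abs, Real.norm_eq_abs, abs_mul, abs_mul, abs_of_nonneg hρ]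
  cases b <;> cases b' <;> simp [sgnB] <;> linarith

/-- The vertex map of a frame with `ρ ≠ 0` is injective. -/
theorem octVertex_injective (hf : Orthonormal ℝ f) (hρ : ρ ≠ 0) :
    Function.Injective (fun ib : Fin 3 × Bool => octVertex c f ρ ib.1 ib.2) := by
  rintro ⟨i, b⟩ ⟨j, b'⟩ h
  simp only [octVertex_eq_sgnB, add_right_inj] at h
  have key := congrArg (fun x => inner ℝ (f i) x) h
  simp only [inner_smul_right, real_inner_self_eq_norm_sq, hf.1 i, one_pow, mul_one] at key
  by_cases hij : i = j
  · subst hij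
    simp only [real_inner_self_eq_norm_sq, hf.1 i, one_pow, mul_one] at key
    have hs : sgnB b = sgnB b' := by
      have := mul_right_cancel₀ hρ key; exact this
    have : b = b' := by
      cases b <;> cases b' <;> simp [sgnB] at hs ⊢ <;> linarith
    simp [this]
  · rw [hf.2 hij, mul_zero] at key
    have : sgnB b * ρ = 0 := key
    rcases mul_eq_zero.1 this with h0 | h0
    · cases b <;> simp [sgnB] at h0
    · exact (hρ h0).elim

/-- Longitudinal component of a difference vector on an EDGE of the frame (edge length `ρ√2`): `(s′⟪f_j, d⟫ − s⟪f_i, d⟫)/√2`. -/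
theorem unit_inner_edge (hρ : ρ ≠ 0) (i j : Fin 3) (b b' : Bool) (d : E3) :
    inner ℝ ((ρ * Real.sqrt 2)⁻¹ • (octVertex c f ρ j b' - octVertex c f ρ i b)) d =
      (sgnB b' * inner ℝ (f j) d - sgnB b * inner ℝ (f i) d) / Real.sqrt 2 := by
  rw [octVertex_sub, inner_smul_left, inner_sub_left, inner_smul_left, inner_smul_left]
  simp only [conj_trivial]
  calc (ρ * Real.sqrt 2)⁻¹ * (sgnB b' * ρ * inner ℝ (f j) d - sgnB b * ρ * inner ℝ (f i) d)
      = (ρ⁻¹ * ρ) * ((sgnB b' * inner ℝ (f j) d - sgnB b * inner ℝ (f i) d) / Real.sqrt 2) := by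
        rw [div_eq_mul_inv]; ring
    _ = _ := by rw [inv_mul_cancel₀ hρ, one_mul]

/-- Longitudinal component of a difference vector on a DIAGONAL of the frame (length `2ρ`): `s′⟪f_i, d⟫`. -/
theorem unit_inner_diag (hρ : ρ ≠ 0) (i : Fin 3) {b b' : Bool} (hbb : b ≠ b') (d : E3) :
    inner ℝ ((2 * ρ)⁻¹ • (octVertex c f ρ i b' - octVertex c f ρ i b)) d = sgnB b' * inner ℝ (f i) d := by
  rw [octVertex_sub, ← sub_smul, smul_smul, inner_smul_left]
  simp only [conj_trivial]
  have hs : (sgnB b' - sgnB b) = 2 * sgnB b' := by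
    cases b <;> cases b' <;> simp_all [sgnB] <;> norm_num
  rw [← sub_mul, hs]
  congr 1
  field_simp

end Geometry

/-! ## §B3 The octahedron form on a frame (PROVED) -/

section FrameForm

variable {c : E3} {f : Fin 3 → E3} {ρ : ℝ} {P : PeriodicConfiguration 3} {r₁ : ℝ} {y z : E3}

/-- The double `finsum` of the octahedron form is the double sum over the six vertices of a frame. -/
theorem octForm_frame (κ₂ : ℝ) (W : E3 → ℝ) (X : Set E3) (β : E3 → E3 → E3)
    (hinj : Function.Injective (fun ib : Fin 3 × Bool => octVertex c f ρ ib.1 ib.2))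
    (hO : ∀ x : E3, InOct P r₁ y z x ↔ ∃ i b, x = octVertex c f ρ i b) :
    octForm κ₂ r₁ W X β P y z =
      ∑ p : Fin 3 × Bool, ∑ q : Fin 3 × Bool, octPairTerm κ₂ r₁ W X β (octVertex c f ρ p.1 p.2) (octVertex c f ρ q.1 q.2) := by
  classical
  set v : Fin 3 × Bool → E3 := fun ib => octVertex c f ρ ib.1 ib.2 with hv
  set V : Finset E3 := Finset.univ.image v with hV
  have hmem : ∀ x, InOct P r₁ y z x → x ∈ (V : Set E3) := fun x hx => by
    obtain ⟨i, b, rfl⟩ := (hO x).1 hx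
    exact Finset.mem_coe.2 (Finset.mem_image.2 ⟨(i, b), Finset.mem_univ _, rfl⟩)
  have hin : ∀ p : Fin 3 × Bool, InOct P r₁ y z (v p) := fun p => (hO _).2 ⟨p.1, p.2, rfl⟩
  have hinjV : ∀ p ∈ (Finset.univ : Finset (Fin 3 × Bool)), ∀ q ∈ (Finset.univ : Finset (Fin 3 × Bool)), v p = v q → p = q :=
    fun p _ q _ h => hinj h
  unfold octForm
  have inner_eq : ∀ p : E3, (∑ᶠ q : E3, if InOct P r₁ y z p ∧ InOct P r₁ y z q then octPairTerm κ₂ r₁ W X β p q else 0) =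
      ∑ q ∈ V, if InOct P r₁ y z p ∧ InOct P r₁ y z q then octPairTerm κ₂ r₁ W X β p q else 0 := by
    intro p
    apply finsum_eq_sum_of_support_subset
    intro q hq
    rw [Function.mem_support] at hq
    by_contra hqV
    exact hq (if_neg fun h' => hqV (hmem q h'.2))
  simp_rw [inner_eq]
  rw [finsum_eq_sum_of_support_subset (s := V)]
  · rw [hV, Finset.sum_image hinjV]
    refine Finset.sum_congr rfl fun p _ => ?_
    rw [Finset.sum_image hinjV]
    refine Finset.sum_congr rfl fun q _ => ?_
    rw [if_pos ⟨hin p, hin q⟩]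
  · intro p hp
    rw [Function.mem_support] at hp
    by_contra hpV
    exact hp (Finset.sum_eq_zero fun q _ => if_neg fun h' => hpV (hmem p h'.1))

/-- The eighteen atoms of a frame potential: `A i p = ⟪f_i, u(vertex p)⟫`. -/
def frameAtom (c : E3) (f : Fin 3 → E3) (ρ : ℝ) (u : E3 → E3) (i : Fin 3) (p : Fin 3 × Bool) : ℝ :=
  inner ℝ (f i) (u (octVertex c f ρ p.1 p.2))

/-- The edge quadratic `Σ_{12 edges} e′²` of the displacement certificate. -/
def octE (A : Fin 3 → Fin 3 × Bool → ℝ) : ℝ :=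
  ((A 1 (1, true) - A 1 (0, true)) - (A 0 (1, true) - A 0 (0, true))) ^ 2 +
  (-(A 1 (1, false) - A 1 (0, true)) - (A 0 (1, false) - A 0 (0, true))) ^ 2 +
  ((A 2 (2, true) - A 2 (0, true)) - (A 0 (2, true) - A 0 (0, true))) ^ 2 +
  (-(A 2 (2, false) - A 2 (0, true)) - (A 0 (2, false) - A 0 (0, true))) ^ 2 +
  ((A 1 (1, true) - A 1 (0, false)) + (A 0 (1, true) - A 0 (0, false))) ^ 2 +
  (-(A 1 (1, false) - A 1 (0, false)) + (A 0 (1, false) - A 0 (0, false))) ^ 2 +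
  ((A 2 (2, true) - A 2 (0, false)) + (A 0 (2, true) - A 0 (0, false))) ^ 2 +
  (-(A 2 (2, false) - A 2 (0, false)) + (A 0 (2, false) - A 0 (0, false))) ^ 2 +
  ((A 2 (2, true) - A 2 (1, true)) - (A 1 (2, true) - A 1 (1, true))) ^ 2 +
  (-(A 2 (2, false) - A 2 (1, true)) - (A 1 (2, false) - A 1 (1, true))) ^ 2 +
  ((A 2 (2, true) - A 2 (1, false)) + (A 1 (2, true) - A 1 (1, false))) ^ 2 +
  (-(A 2 (2, false) - A 2 (1, false)) + (A 1 (2, false) - A 1 (1, false))) ^ 2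

/-- The diagonal quadratic `Σ_a D_a²` of the displacement certificate. -/
def octD (A : Fin 3 → Fin 3 × Bool → ℝ) : ℝ :=
  (A 0 (0, true) - A 0 (0, false)) ^ 2 + (A 1 (1, true) - A 1 (1, false)) ^ 2 + (A 2 (2, true) - A 2 (2, false)) ^ 2

/-- `octD_le_octE` (docstring added by the landing lane; see the module docstring). [formal bookkeeping] -/
theorem octD_le_octE (A : Fin 3 → Fin 3 × Bool → ℝ) : octD A ≤ octE A := octahedron_disp_certificate A

/-- `octD_nonneg` (docstring added by the landing lane; see the module docstring). [formal bookkeeping] -/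
theorem octD_nonneg (A : Fin 3 → Fin 3 × Bool → ℝ) : 0 ≤ octD A := by unfold octD; positivity

/-- The value of one ordered pair term of the octahedron form on a frame at `κ₂ = ½`, in atoms: `0` on the diagonal of the index set,
`W₀·¼c(2ρ)·D²` on an antipodal pair, `W₀·¼·e′²/2` on an edge. -/
def octTermVal (A : Fin 3 → Fin 3 × Bool → ℝ) (cρ W₀ : ℝ) (p q : Fin 3 × Bool) : ℝ :=
  if p = q then 0 else W₀ * (if p.1 = q.1 then (1 / 4) * cρ * (sgnB q.2 * (A p.1 q - A p.1 p)) ^ 2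
    else (1 / 4) * ((sgnB q.2 * (A q.1 q - A q.1 p) - sgnB p.2 * (A p.1 q - A p.1 p)) ^ 2 / 2))

/-- The thirty-six pair terms re-summed: `Σ_p Σ_q = W₀·[¼·Σ₁₂e′² + (c/2)·Σ₃D²]` (each unordered edge twice with `e′²/2`, each diagonal twice). -/
theorem octTermVal_sum (A : Fin 3 → Fin 3 × Bool → ℝ) (cρ W₀ : ℝ) :
    ∑ p : Fin 3 × Bool, ∑ q : Fin 3 × Bool, octTermVal A cρ W₀ p q = W₀ * ((1 / 4) * octE A + cρ / 2 * octD A) := by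
  simp only [octTermVal, octE, octD, Fintype.sum_prod_type, Fin.sum_univ_three, Fintype.sum_bool, sgnB, Prod.mk.injEq,
    Fin.reduceEq, Fin.isValue, Bool.true_eq_false, Bool.false_eq_true, and_true, and_false, ↓reduceIte]
  ring

/-- Each pair term of the octahedron form on a clean plateau frame carrying a coboundary is the atom value `octTermVal`. -/
theorem octPairTerm_frame (hf : Orthonormal ℝ f) (hρ : 0 < ρ) (W : E3 → ℝ) (X : Set E3) (β : E3 → E3 → E3) (u : E3 → E3)
    {W₀ : ℝ} (hedge : ρ * Real.sqrt 2 ≤ r₁) (hdiag : r₁ < 2 * ρ)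
    (hX : ∀ i b, octVertex c f ρ i b ∉ X) (hW : ∀ i b, W (octVertex c f ρ i b) = W₀)
    (hu : ∀ i b j b', β (octVertex c f ρ i b) (octVertex c f ρ j b') = u (octVertex c f ρ j b') - u (octVertex c f ρ i b))
    (p q : Fin 3 × Bool) :
    octPairTerm (1 / 2) r₁ W X β (octVertex c f ρ p.1 p.2) (octVertex c f ρ q.1 q.2) =
      octTermVal (frameAtom c f ρ u) (ljD2 (2 * ρ) - ljD1 (2 * ρ) / (2 * ρ)) W₀ p q := by
  have hinj := octVertex_injective (c := c) hf hρ.ne'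
  obtain ⟨i, b⟩ := p
  obtain ⟨j, b'⟩ := q
  dsimp only
  unfold octTermVal
  by_cases hpq : ((i, b) : Fin 3 × Bool) = (j, b')
  · obtain ⟨hij, hbb⟩ := Prod.mk.inj hpq
    subst hij; subst hbb
    rw [if_pos rfl]
    unfold octPairTerm
    rw [if_neg fun h => h.1 rfl]
  · rw [if_neg hpq]
    have hne : octVertex c f ρ i b ≠ octVertex c f ρ j b' := fun h => hpq (hinj h)
    unfold octPairTerm
    rw [if_pos ⟨hne, hX j b'⟩, hW]
    dsimp only
    congr 1
    by_cases hij : i = j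
    · subst hij
      have hbb : b ≠ b' := fun h => hpq (by rw [h])
      rw [if_pos rfl]
      unfold octCoef pairElong
      rw [dist_octVertex_diag hf hρ.le i hbb, if_neg (not_le.2 hdiag), hu, unit_inner_diag hρ.ne' i hbb, inner_sub_right]
      simp only [frameAtom]
    · rw [if_neg hij]
      unfold octCoef pairElong
      rw [dist_octVertex_edge hf hρ.le hij, if_pos hedge, hu, unit_inner_edge hρ.ne' i j, inner_sub_right, inner_sub_right, div_pow,
        Real.sq_sqrt (by norm_num : (0:ℝ) ≤ 2)]
      simp only [frameAtom]
      all_goals ring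

/-- ★ THE PLATEAU OCTAHEDRON IS NON-NEGATIVE: on a frame of the window (`ρ√2 ≤ r₁ < 2ρ`, `−½ ≤ c(2ρ)`) whose octahedron is clean, carries a constant
non-negative weight and a COBOUNDARY field, the octahedron form at `κ₂ = ½` is `W₀·[¼Σe′² + (c(2ρ)/2)ΣD²] ≥ 0` by the displacement certificate. -/
theorem octForm_frame_nonneg (hf : Orthonormal ℝ f) (hρ : 0 < ρ) (W : E3 → ℝ) (X : Set E3) (β : E3 → E3 → E3) (u : E3 → E3) {W₀ : ℝ}
    (hW₀ : 0 ≤ W₀) (hedge : ρ * Real.sqrt 2 ≤ r₁) (hdiag : r₁ < 2 * ρ) (hc : -(1 / 2) ≤ ljD2 (2 * ρ) - ljD1 (2 * ρ) / (2 * ρ))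
    (hO : ∀ x : E3, InOct P r₁ y z x ↔ ∃ i b, x = octVertex c f ρ i b)
    (hX : ∀ i b, octVertex c f ρ i b ∉ X) (hW : ∀ i b, W (octVertex c f ρ i b) = W₀)
    (hu : ∀ i b j b', β (octVertex c f ρ i b) (octVertex c f ρ j b') = u (octVertex c f ρ j b') - u (octVertex c f ρ i b)) :
    0 ≤ octForm (1 / 2) r₁ W X β P y z := by
  have hinj := octVertex_injective (c := c) hf hρ.ne'
  rw [octForm_frame (1 / 2) W X β hinj hO]
  simp_rw [octPairTerm_frame hf hρ W X β u hedge hdiag hX hW hu]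
  rw [octTermVal_sum]
  have cert := octD_le_octE (frameAtom c f ρ u)
  have hD := octD_nonneg (frameAtom c f ρ u)
  exact mul_nonneg hW₀ (by nlinarith)

end FrameForm

/-! ## §B4 ★★ (K₀) at the designate (PROVED) -/

section Plateau

/-- ★★ **(K₀) PROVED**: for EVERY class, every quantisation floor `b₁ ≥ 1/8` and any remaining dials, the plateau octahedral functional of the
Volterra field of a quantised system is non-negative on a reference with framed octahedra of the window (`τ = 3/100`, `r₁ = 6/5`, `r₂ = 3/2`,
`κ₂ = ½`).  Local exactness (`volterraField_localExact_of_diam`, diameter `2ρ ≤ 1.382`, `3τ·2ρ < 1/8 ≤ b₁`) supplies the potential, §B3 the sign. -/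
theorem octPlateauQ_designate (cls : Set E3 → Prop) (s lam ℓ μ₀ ϱ b₀ r_S ϱχ : ℝ) {b₁ : ℝ} (hb : 1 / 8 ≤ b₁) :
    OctPlateauQ cls s lam ℓ μ₀ (3 / 100) ϱ b₀ r_S b₁ ϱχ (6 / 5) (3 / 2) (1 / 2) (679 / 1000) (691 / 1000) := by
  intro P C X β₀ k S m D σ h1 h2 hcl h3 h4 h5 h6 h7 h8 h9 hq h10 h11 hFr
  unfold octPlateauL
  refine Finset.sum_nonneg fun y hy => ?_
  unfold octSiteWith
  refine finsum_nonneg fun z => ?_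
  split_ifs with hz
  · obtain ⟨⟨hzP, hr1, hr2⟩, hclean, hplat⟩ := hz
    obtain ⟨c, f, ρ, hf, hρ1, hρ2, hy', hz', hO⟩ := hFr y (P.mem_points_of_mem_motif hy) z hzP hr1 hr2
    have hρ : 0 < ρ := by linarith
    have hin : ∀ i b, InOct P (6 / 5) y z (octVertex c f ρ i b) := fun i b => (hO _).2 ⟨i, b, rfl⟩
    -- local exactness on the six vertices
    obtain ⟨u, hu⟩ := volterraField_localExact_of_diam (X := X) h8 hq h10 (by norm_num) (δ := 2 * ρ) (by linarith)
      (K := {x | InOct P (6 / 5) y z x}) (fun x hx => hx.1) (fun x hx => hclean x hx)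
      (fun p hp q hq' => by
        obtain ⟨i, b, rfl⟩ := (hO p).1 hp
        obtain ⟨j, b', rfl⟩ := (hO q).1 hq'
        exact dist_octVertex_le hf hρ.le i j b b')
    have hs2 : Real.sqrt 2 ≤ 3 / 2 := by
      rw [show (3 / 2 : ℝ) = Real.sqrt ((3 / 2) ^ 2) by rw [Real.sqrt_sq (by norm_num)]]
      exact Real.sqrt_le_sqrt (by norm_num)
    have hedge : ρ * Real.sqrt 2 ≤ 6 / 5 := by
      nlinarith [Real.sqrt_nonneg 2]
    have key := octForm_frame_nonneg (P := P) (y := y) (z := z) hf hρ (siteW ϱχ D σ X ϱ C) X (volterraField P S β₀) u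
      (siteW_nonneg X ϱ C (octVertex c f ρ 0 false)) hedge (by linarith) (ljBar_diag_window hρ1 hρ2) hO
      (fun i b => hclean _ (hin i b)) (fun i b => hplat _ _ (hin i b) (hin 0 false)) (fun i b j b' => hu _ (hin i b) _ (hin j b'))
    positivity
  · exact le_rfl

end Plateau

end Summit.AtomisticToContinuum.Crystallization.Theorems.ChargedEnergyGapChartDial
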